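import Summits.ValiantsHypothesis.ValiantsHypothesis.Theses.UlrichPadded
import Literature.Computability.AlgebraicComplexity.VonZurGathenSingPermHeight
import Literature.Computability.AlgebraicComplexity.AlperBogartVelascoSubspace
import Literature.Computability.AlgebraicComplexity.StandardFamiliesProofs
import Literature.RingTheory.RegularLocalRing.GrothendieckSamuelHypersurfaceProofs

/-!
# Crux `PermHypersurfaceFactorial` (stmt-ValiantsHypothesis-5666), line `derivation-symbolic-square` —
stub 1 `stub_missingPartial`: a prime of `S_n` of height `≤ 3` misses a partial derivative

For `n ≥ 3` and `S_n = ℂ[x_{n×n}]/(per_n)`: if `P` is a prime of `S_n` of height `≤ 3` with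
preimage `𝔮` in `ℂ[x]`, then some partial derivative `∂per_n/∂x_ij` is not in `𝔮`.

Proof. If all the partials were in `𝔮`, then, `per_n` being in `𝔮` as well, `𝔮` would contain
von zur Gathen's singular ideal `singPermIdeal ℂ n = (per_n, ∂per_n/∂x_ij)`, whence `ht 𝔮 ≥ 5`
(von zur Gathen 1987, Lemma 2.3, PROVED in the tree in the height form
`AlperBogartVelasco.five_le_height_of_singPermIdeal_le`; this is where `3 ≤ n` is consumed).  On
the other hand `ht 𝔮 = ht P + 1 ≤ 4`: `(S_n)_P ≃+* ℂ[x]_𝔮 ⧸ (per_n)`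
(`nonempty_ringEquiv_localization_quotient_span_singleton`), the Krull dimension of a localisation
at a prime is the height of the prime, and cutting the noetherian local domain `ℂ[x]_𝔮` by the
non-zero element `per_n / 1` of its maximal ideal drops the dimension by exactly one
(`ringKrullDim_quotient_span_singleton_succ_eq_ringKrullDim_of_mem_nonZeroDivisors`).
-/

noncomputable section

namespace Summit.ValiantsHypothesis.Theorems.PermHypersurfaceFactorial

open MvPolynomial IsLocalRing Literature.Computability.AlgebraicComplexity
open scoped nonZeroDivisors

/-- **Height bookkeeping for hypersurface rings.** For a noetherian domain `R`, `0 ≠ f ∈ R`, and a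
prime `P` of `R ⧸ (f)` with preimage `p` in `R`: `ht P + 1 = ht p` — both sides are Krull
dimensions of local rings, `(R ⧸ (f))_P ≃+* R_p ⧸ (f)`, and `f / 1` is a non-zero-divisor in the
maximal ideal of the noetherian local domain `R_p`. [folklore] -/
theorem height_add_one_eq_height_comap_mk_span_singleton {R : Type*} [CommRing R] [IsDomain R]
    [IsNoetherianRing R] {f : R} (hf : f ≠ 0) (P : Ideal (R ⧸ Ideal.span {f})) [P.IsPrime] :
    (P.height : WithBot ℕ∞) + 1 = (P.comap (Ideal.Quotient.mk (Ideal.span {f}))).height := by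
  set p : Ideal R := P.comap (Ideal.Quotient.mk (Ideal.span {f})) with hp
  haveI hpP : p.IsPrime := Ideal.comap_isPrime _ _
  -- `f ∈ p`
  have hfp : f ∈ p := by
    rw [hp, Ideal.mem_comap,
      Ideal.Quotient.eq_zero_iff_mem.mpr (Ideal.mem_span_singleton_self f)]
    exact P.zero_mem
  -- `f / 1` is a non-zero element of the maximal ideal of the local domain `R_p`
  have hfm : algebraMap R (Localization.AtPrime p) f ∈ maximalIdeal (Localization.AtPrime p) :=
    (IsLocalization.AtPrime.to_map_mem_maximal_iff (Localization.AtPrime p) p f).mpr hfp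
  have hf0 : algebraMap R (Localization.AtPrime p) f ≠ 0 := by
    intro h0
    apply hf
    apply IsLocalization.injective (Localization.AtPrime p) p.primeCompl_le_nonZeroDivisors
    rw [h0, map_zero]
  have hdim : ringKrullDim (Localization.AtPrime p ⧸
      Ideal.span {algebraMap R (Localization.AtPrime p) f}) + 1 =
        ringKrullDim (Localization.AtPrime p) :=
    ringKrullDim_quotient_span_singleton_succ_eq_ringKrullDim_of_mem_nonZeroDivisors
      (mem_nonZeroDivisors_of_ne_zero hf0) hfm
  -- `(R ⧸ (f))_P ≃+* R_p ⧸ (f)`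
  obtain ⟨e⟩ :=
    Literature.RingTheory.RegularLocalRing.nonempty_ringEquiv_localization_quotient_span_singleton
      f P
  rw [← IsLocalization.AtPrime.ringKrullDim_eq_height P (Localization.AtPrime P),
    ← IsLocalization.AtPrime.ringKrullDim_eq_height p (Localization.AtPrime p),
    ringKrullDim_eq_of_ringEquiv e]
  exact hdim

/-- **Stub 1 of line `derivation-symbolic-square` (vzG input + height bookkeeping): a prime of
`S_n` of height `≤ 3` misses a partial.** For `n ≥ 3` and a prime `P` of `S_n = ℂ[x]/(per_n)`
with `ht P ≤ 3`, some `∂per_n/∂x_ij` is not in the preimage `𝔮` of `P` in `ℂ[x]`: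
`ht 𝔮 = ht P + 1 ≤ 4`, while `𝔮 ⊇ singPermIdeal ℂ n` would force `ht 𝔮 ≥ 5` (von zur Gathen
1987, Lemma 2.3, tree form `AlperBogartVelasco.five_le_height_of_singPermIdeal_le`).
[cite: Vonzurgathen1987, Lemma 2.3] -/
theorem stub_missingPartial :
    ∀ n : ℕ, 3 ≤ n →
      ∀ (P : Ideal (MvPolynomial (Fin n × Fin n) ℂ ⧸ Ideal.span {perPoly (Fin n) ℂ})) [P.IsPrime],
        P.height ≤ 3 →
          ∃ ij : Fin n × Fin n, pderiv ij (perPoly (Fin n) ℂ) ∉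
            P.comap (Ideal.Quotient.mk (Ideal.span {perPoly (Fin n) ℂ})) := by
  intro n hn P hP hht
  set q : Ideal (MvPolynomial (Fin n × Fin n) ℂ) :=
    P.comap (Ideal.Quotient.mk (Ideal.span {perPoly (Fin n) ℂ})) with hq
  haveI hqP : q.IsPrime := Ideal.comap_isPrime _ _
  by_contra h
  push Not at h
  -- `per_n ∈ q`, hence `singPermIdeal ℂ n ≤ q`
  have hfq : perPoly (Fin n) ℂ ∈ q := by
    rw [hq, Ideal.mem_comap,
      Ideal.Quotient.eq_zero_iff_mem.mpr (Ideal.mem_span_singleton_self (perPoly (Fin n) ℂ))]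
    exact P.zero_mem
  have hle : VonZurGathen.singPermIdeal ℂ n ≤ q := by
    rw [VonZurGathen.singPermIdeal, Ideal.span_le, Set.insert_subset_iff, Set.range_subset_iff]
    exact ⟨hfq, h⟩
  -- von zur Gathen: `ht q ≥ 5`
  have h5 : (5 : ℕ∞) ≤ q.height :=
    AlperBogartVelasco.five_le_height_of_singPermIdeal_le two_ne_zero hn q hle
  -- bookkeeping: `ht P + 1 = ht q`
  have hbook : (P.height : WithBot ℕ∞) + 1 = q.height :=
    height_add_one_eq_height_comap_mk_span_singleton (perPoly_ne_zero (Fin n) ℂ) P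
  -- `ht P` is finite (noetherian ring), so compare in `ℕ`
  obtain ⟨k, hk⟩ := ENat.ne_top_iff_exists.mp (ne_top_of_le_ne_top (by decide) hht)
  rw [← hk] at hht hbook
  have hk3 : k ≤ 3 := by exact_mod_cast hht
  have hqk : q.height = (k + 1 : ℕ) := by
    have h1 : ((q.height : ℕ∞) : WithBot ℕ∞) = ((k + 1 : ℕ) : ℕ∞) := by
      rw [← hbook]; rfl
    exact (WithBot.coe_eq_coe.mp h1)
  rw [hqk] at h5
  have h5' : 5 ≤ k + 1 := by exact_mod_cast h5
  omega

end Summit.ValiantsHypothesis.Theorems.PermHypersurfaceFactorial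

end
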